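import Mathlib
import Literature.Analysis.FluidPDE.TypeIAncientMild
import Summits.NavierStokesRegularity.NavierStokesRegularity.Theses.SlicedKelvin

/-!
# Crux `SlicedKelvin.FluxZoom` (stmt-NavierStokesRegularity-15603), line `registered`,
# stub `stub_oseenAncientMild`: bounded continuous Oseen-ancient fields are bounded ancient mild
# solutions in the duality sense

Support file (theorems only, `--supports stmt-NavierStokesRegularity-15603`) for the lead's
skeleton of the crux `FluxZoom` of route `SlicedKelvin`. A field `V : ℝ → ℝ³ → ℝ³` which is
continuous on the open slab `(−∞, 0) × ℝ³`, has weakly divergence-free slices `V t` (`t < 0`), is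
bounded by `N` on the slab, and satisfies the Oseen integral identity
`V(t) = e^{(t−s)Δ}V(s) − B¹ₛ(V, V)(t)` pointwise for all `s < t < 0`, is a bounded ancient mild
solution in the duality sense of `SelfSimilar.lean` (`IsBoundedAncientMildSolution 1 V`:
`IsAncientMildSolution 1 V ∧ IsBoundedOn (Iio 0) V`), and its slices `V t`, `t < 0`, are a.e.
strongly measurable.

## Proof

Verbatim the proof of `IsTypeIAncientMild.isMildNSSolutionBetween` (`TypeIAncientMild.lean`),
with the constant bound `N` in place of the Type I bound `C/√(−t)`
(`oseenAncient_isMildNSSolutionBetween`, stated for a general finite-dimensional inner product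
space). Fix `s < t < 0` and a solenoidal test field `φ`. The field is jointly a.e. strongly
measurable on `(s, t) × E` (continuity on the open slab) and bounded there by `N ≥ 0`, so the
tested identities of `NSBoundedMildOseenDuhamel.lean` apply: the caloric term gives
`∫⟪V(s), e^{(t−s)Δ}φ⟫` (`integral_inner_heatExtension_comm_of_bound`), the Duhamel term gives
`−∫ₛᵗ∫⟪V(τ), (V(τ)·∇)e^{(t−τ)Δ}φ⟫` (`integral_inner_oseenDuhamel_eq_neg_intervalIntegral`), and the
force term vanishes; the pairings are integrable by `exists_norm_oseenDuhamel_bounded_le`,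
`aestronglyMeasurable_oseenDuhamel` and the continuity of the slices
(`oseenAncient_continuous_slice`). Boundedness on `(−∞, 0)` is the hypothesis, and the slices are
measurable because they are continuous.

No named fact is assumed: every ingredient is a theorem of the tree.

## References

* G. Koch, N. Nadirashvili, G. Seregin, V. Šverák, *Liouville theorems for the Navier–Stokes
  equations and applications*, Acta Math. 203 (2009) = arXiv:0709.3599, §4 p. 8, §6 p. 11,
  Rem. 4.1 [KochNadirashviliSereginSverak2009].
* P. G. Lemarié-Rieusset, *The Navier–Stokes Problem in the 21st Century* (2016), Thm. 6.1,
  (6.12) ⇒ (6.11) [LemarieRieusset2016].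
-/

noncomputable section

-- the summit and its single sub-problem share the name (CONVENTIONS §1), as in every Theorems file
set_option linter.dupNamespace false

open MeasureTheory Set Function Filter Topology TopologicalSpace
open scoped RealInnerProductSpace ENNReal NNReal

namespace Summit.NavierStokesRegularity.NavierStokesRegularity.Theorems.FluxZoom.Registered

open Literature.Analysis.FluidPDE Literature.Analysis

/-- **Slices of a field continuous on the open slab are continuous**: if `uncurry V` is
continuous on `(−∞, 0) × X` then every slice `V t`, `t < 0`, is continuous (restrict along
`x ↦ (t, x)`). -/
theorem oseenAncient_continuous_slice {X F : Type*} [TopologicalSpace X] [TopologicalSpace F]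
    {V : ℝ → X → F} (hcont : ContinuousOn (uncurry V) (Iio 0 ×ˢ univ)) {t : ℝ} (ht : t < 0) :
    Continuous (V t) :=
  hcont.comp_continuous (Continuous.prodMk_right t) fun x => ⟨mem_Iio.2 ht, mem_univ x⟩

/-- **Oseen integral form ⇒ duality form for bounded continuous ancient fields** (KNSS 2009,
Rem. 4.1: mild ⇒ weak; Lemarié-Rieusset 2016, Thm. 6.1, (6.12) ⇒ (6.11)). If `V` is continuous
on `(−∞, 0) × E`, bounded by `N` there, and satisfies
`V t x = e^{(t−s)Δ}V(s)(x) − B¹ₛ(V, V)(t)(x)` for all `s < t < 0`, then the two-time duality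
identity `IsMildNSSolutionBetween 1 0 V s t` holds for all `s < t < 0`: tested against a
solenoidal test field `φ`, the caloric term gives `∫⟪V(s), e^{(t−s)Δ}φ⟫`
(`integral_inner_heatExtension_comm_of_bound`), the Duhamel term gives
`−∫ₛᵗ∫⟪V(τ), (V(τ)·∇)e^{(t−τ)Δ}φ⟫` (`integral_inner_oseenDuhamel_eq_neg_intervalIntegral`), and the
force term vanishes. The proof of `IsTypeIAncientMild.isMildNSSolutionBetween` with the constant
bound `N`. -/
theorem oseenAncient_isMildNSSolutionBetween
    {E : Type*} [NormedAddCommGroup E] [InnerProductSpace ℝ E] [FiniteDimensional ℝ E]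
    [MeasurableSpace E] [BorelSpace E] {V : ℝ → E → E} {N : ℝ}
    (hcont : ContinuousOn (uncurry V) (Iio 0 ×ˢ univ)) (hbdd : ∀ t < 0, ∀ x, ‖V t x‖ ≤ N)
    (hmild : ∀ s t : ℝ, s < t → t < 0 → ∀ x,
      V t x = UnboundedOperators.heatExtension (V s) (t - s) x - oseenDuhamel 1 s V V t x)
    {s t : ℝ} (hst : s < t) (ht : t < 0) :
    IsMildNSSolutionBetween 1 0 V s t := by
  intro φ hφ hdiv
  have hs : s < 0 := hst.trans ht
  have hM : 0 ≤ N := (norm_nonneg _).trans (hbdd t ht 0)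
  have huM : ∀ τ ∈ Ioo s t, ∀ y, ‖V τ y‖ ≤ N := fun τ hτ y => hbdd τ (hτ.2.trans ht) y
  -- joint measurability on the slab `(s, t) × E` (continuity on the open slab)
  have hmeas : AEStronglyMeasurable (uncurry V)
      ((volume : Measure (ℝ × E)).restrict (Ioo s t ×ˢ univ)) :=
    (hcont.mono (prod_mono (fun τ hτ => hτ.2.trans ht) Subset.rfl)).aestronglyMeasurable
      (measurableSet_Ioo.prod MeasurableSet.univ)
  have hφc : Continuous φ := hφ.contDiff.continuous
  -- the tested identities of the Duhamel term and of the caloric term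
  have hB := integral_inner_oseenDuhamel_eq_neg_intervalIntegral one_pos hmeas hM huM hst le_rfl
    hφ hdiv
  have hA := integral_inner_heatExtension_comm_of_bound
    (oseenAncient_continuous_slice hcont hs).aestronglyMeasurable (fun x => hbdd s hs x) hφc
    hφ.hasCompactSupport (sub_pos.2 hst)
  have hut : ∀ x, V t x =
      UnboundedOperators.heatExtension (V s) (t - s) x - oseenDuhamel 1 s V V t x :=
    fun x => hmild s t hst ht x
  -- integrability of the three pairings
  obtain ⟨K, -, hK⟩ := exists_norm_oseenDuhamel_bounded_le (E := E)
  have hiB : Integrable (fun x => ⟪oseenDuhamel 1 s V V t x, φ x⟫) (volume : Measure E) :=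
    integrable_inner_of_norm_le_of_hasCompactSupport
      (aestronglyMeasurable_oseenDuhamel one_pos hmeas hmeas hM huM huM hst le_rfl)
      (fun x => hK one_pos hst hM huM huM x) hφc hφ.hasCompactSupport
  have hiU : Integrable (fun x => ⟪V t x, φ x⟫) (volume : Measure E) :=
    integrable_inner_of_continuous_of_hasCompactSupport (oseenAncient_continuous_slice hcont ht)
      hφc hφ.hasCompactSupport
  have hiA : Integrable
      (fun x => ⟪UnboundedOperators.heatExtension (V s) (t - s) x, φ x⟫) (volume : Measure E) := by
    refine (hiU.add hiB).congr (Eventually.of_forall fun x => ?_)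
    simp only [Pi.add_apply, hut x, inner_sub_left, sub_add_cancel]
  -- assemble
  calc ∫ x, ⟪V t x, φ x⟫
      = ∫ x, (⟪UnboundedOperators.heatExtension (V s) (t - s) x, φ x⟫ -
          ⟪oseenDuhamel 1 s V V t x, φ x⟫) := by
        refine integral_congr_ae (Eventually.of_forall fun x => ?_)
        simp only [hut x, inner_sub_left]
    _ = (∫ x, ⟪UnboundedOperators.heatExtension (V s) (t - s) x, φ x⟫) -
          ∫ x, ⟪oseenDuhamel 1 s V V t x, φ x⟫ := integral_sub hiA hiB
    _ = (∫ x, ⟪V s x, heatTest 1 φ (t - s) x⟫) +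
          (∫ τ in s..t, ∫ x, ⟪V τ x, convect (V τ) (heatTest 1 φ (t - τ)) x⟫) +
          ∫ τ in s..t, ∫ x, ⟪(0 : ℝ → E → E) τ x, heatTest 1 φ (t - τ) x⟫ := by
        rw [hA, hB, heatTest_of_pos one_pos (sub_pos.2 hst), one_mul]
        simp

/-- **Stub `stub_oseenAncientMild` of the crux `SlicedKelvin.FluxZoom`, line `registered`.** A
field `V : ℝ → ℝ³ → ℝ³`, continuous on `(−∞, 0) × ℝ³`, with weakly divergence-free slices,
bounded by `N`, satisfying the Oseen identity `V(t) = e^{(t−s)Δ}V(s) − B¹ₛ(V, V)(t)` for all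
`s < t < 0`, is a bounded ancient mild solution in the duality sense of `SelfSimilar.lean`
(`IsBoundedAncientMildSolution 1 V`: the weakly divergence-free slices and the two-time duality
identity `oseenAncient_isMildNSSolutionBetween` give `IsAncientMildSolution 1 V`, the bound `N`
gives `IsBoundedOn (Iio 0) V`), with a.e. strongly measurable slices (they are continuous,
`oseenAncient_continuous_slice`). Unconditional: no named fact is taken as a hypothesis. -/
theorem stub_oseenAncientMild :
    ∀ (V : ℝ → EuclideanSpace ℝ (Fin 3) → EuclideanSpace ℝ (Fin 3)) (N : ℝ),
      ContinuousOn (Function.uncurry V) (Set.Iio 0 ×ˢ Set.univ) →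
      (∀ t < 0, Literature.Analysis.FluidPDE.IsWeaklyDivFree (V t)) →
      (∀ t < 0, ∀ x, ‖V t x‖ ≤ N) →
      (∀ s t : ℝ, s < t → t < 0 → ∀ x,
        V t x = Literature.Analysis.UnboundedOperators.heatExtension (V s) (t - s) x -
          Literature.Analysis.FluidPDE.oseenDuhamel 1 s V V t x) →
      Literature.Analysis.FluidPDE.IsBoundedAncientMildSolution 1 V ∧
        ∀ t < 0, MeasureTheory.AEStronglyMeasurable (V t) MeasureTheory.volume := by
  intro V N hcont hdiv hbdd hmild
  exact ⟨⟨⟨hdiv, fun s t hst ht => oseenAncient_isMildNSSolutionBetween hcont hbdd hmild hst ht⟩,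
      ⟨N, fun t ht x => hbdd t ht x⟩⟩,
    fun t ht => (oseenAncient_continuous_slice hcont ht).aestronglyMeasurable⟩

end Summit.NavierStokesRegularity.NavierStokesRegularity.Theorems.FluxZoom.Registered

end
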